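import Summits.BirchSwinnertonDyer.BirchSwinnertonDyer.Theorems.PrintCFramTCubeNoNineTorsion
import Literature.NumberTheory.EllipticCurves.DivisionPolynomialMultiplication
import HarnessLib

/-!
# `y² = x³ + k` has NO point of order `9` over a field containing `√−3` but no primitive ninth root of unity;
# hence no `K_𝔭`-point of order `9` at a `3`-frame: `W_K(K_𝔭)[3^∞] = W_K(K_𝔭)[3] ⊆ W[3]`
# (cell `bsd-print-cfram`, seat p3 g3; regime T item `PrintCFram.LocalThreeTorsionBSDThree` = stmt-BirchSwinnertonDyer-20699)

HONEST FRAMING (cell `bsd-print-cfram`, run/shared/lean/pub/bsd-print-cfram/, D-0131 (2) print tier): the cell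
works the partition leaf `CornerF ∧ p ramified in the CM field K` in PARTITION currency — a leaf or a cell counts
only when its theorem is in the kernel BY NAME. Nothing is closed here; theorems only (no definition, no named
fact, no `sorry`). This file puts into the kernel LEMMA 1 of p3's STEP-0 census memo (HOME/p3/T-TORSION-GROWTH.md,
evidence #10 on 20699: «`W[𝔭³]` rational over `F ⊇ K_𝔭` forces `μ₉ ⊂ F`») in its explicit `j = 0` form, and
turns ty3 PART H's column `dP = #W_K(K_𝔭)[3^∞]` (the local defect displayed by ty2's T package p559111, made
finite and `≤ #W(ℚ₃)[3^∞]·#W'(ℚ₃)[3^∞]` by p3 p560593) into «the order of a subgroup of `W[3]`» class-wide: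

* §1 `exists_ninth_root_of_phi_three_root` — pure algebra: `θ² = −3`, `k ≠ 0`,
  `x⁹ − 96k x⁶ + 48k² x³ + 64k³ = 0` ⟹ `F` contains `ζ` with `ζ⁹ = 1 ≠ ζ³` (with `w = x³/4k`:
  `w³ − 24w² + 3w + 1 = 0`, `η = (−2 + 24w − w²)/3` is a root of `η³ − 3η + 1` — the level-`3` abscissae
  generate `ℚ(ζ₉)⁺` — and `ζ = (η(η²−1) + θ)/(2(η²−1))` has `ζ³ = (−1 + θ)/2`; two explicit `linear_combination`
  certificates);
* §2 `mordellCurve_φ_three_evalEval` (Mathlib's `φ₃` on `y² = x³ + k` is `x⁹ − 96k x⁶ + 48k² x³ + 64k³`) and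
  `phi_three_eq_zero_of_three_smul_eq` (`3P = (0, s) ⟹ φ₃(x(P)) = 0`, from the tree's multiplication-by-`n`
  formula `zsmul_some_eq_some_φ_div`, Silverman Ex. 3.7 (d));
* §3 **`three_smul_eq_zero_of_nine_smul_eq_zero`** — `F ∋ θ`, `θ² = −3`, no primitive ninth root of unity in
  `F`, `k ≠ 0`: every `F`-point `P` of `y² = x³ + k` with `9P = O` has `3P = O`; and
  `three_smul_eq_zero_of_pow_smul_eq_zero` (`3ⁿP = O ⟹ 3P = O`). Proof: `Q = 3P ≠ O` is `3`-torsion, so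
  `x(Q) = 0` or `x(Q)³ = −4k` (tree); if `x(Q) = 0`, §2 + §1; else with p4's CM automorphism `[ω]` and chord
  identity (`PrintCFramTCubeNoNineTorsion`), `R = [ω]P − P` has `9R = O`, `3R = [ω]Q − Q ≠ O` and
  `([ω] − 1)(3R) = O`, so `x(3R) = 0` and the first case applies to `R`;
* companion file `PrintCFramMordellNoNineTorsionLocal.lean` (§4–§5): no primitive ninth root of unity in a field of
  degree `≤ 2` over `ℚ₃` (`Φ₉` irreducible over `ℚ₃`), hence at a `3`-frame every point of `W_K(K_𝔭)` killed by a
  power of `3` is killed by `3`: `W_K(K_𝔭)[3^∞] = W_K(K_𝔭)[3]`.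

What is NOT here: the same over the local anticyclotomic layers `K^ac_{n,𝔭}` (needs «`ζ₉ ∉ K^ac_{n,𝔭}`», the
dihedral argument of the memo — §3 applies verbatim once that is supplied); the `j = 54000 / −12288000`
members (the census covers them numerically). beyond-print: NO (Silverman Ex. 3.7, Serre IV §4).
References: [SilvermanAEC2009] Exercise 3.7 (d),(f), III.10; [SerreLocalFields1979] IV §4 Prop. 17;
p4 `Theorems/PrintCFramTCubeNoNineTorsion.lean`; p3 `X12/O11/AnticyclotomicLocalTorsionThree.lean`;
HOME/p3/T-TORSION-GROWTH.md §2.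
-/

set_option linter.dupNamespace false
set_option autoImplicit false

noncomputable section

open scoped Classical
open WeierstrassCurve Polynomial Literature.NumberTheory.EllipticCurves
  Literature.NumberTheory.EllipticCurves.Rank1Residual
  Summit.BirchSwinnertonDyer.Rank1Residual Summit.BirchSwinnertonDyer.Rank1Residual.X12
  Summit.BirchSwinnertonDyer.BirchSwinnertonDyer.Theorems.PrintCFram.GlobalDefect

namespace Summit.BirchSwinnertonDyer.BirchSwinnertonDyer.Theorems.PrintCFram.NoZetaNine

variable {F : Type*} [Field F] [CharZero F]

/-! ## §1 A primitive ninth root of unity from a root of `φ₃` -/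

/-- **From a level-`3` abscissa to `ζ₉`.** If `θ² = −3`, `k ≠ 0` and `x⁹ − 96k x⁶ + 48k² x³ + 64k³ = 0`
(the numerator `φ₃` of `x(3P)` on `y² = x³ + k`), then `F` contains a primitive ninth root of unity:
with `w = x³/(4k)` one has `w³ − 24w² + 3w + 1 = 0`, `η := (−2 + 24w − w²)/3` satisfies
`η³ − 3η + 1 = 0` (so `ℚ(w) = ℚ(η) = ℚ(ζ₉)⁺`), `η² ≠ 1`, and `ζ := (η(η² − 1) + θ)/(2(η² − 1))` has
`ζ³ = (−1 + θ)/2`, a primitive cube root of unity, hence `ζ⁹ = 1 ≠ ζ³`. [folklore] -/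
theorem exists_ninth_root_of_phi_three_root {θ : F} (hθ : θ ^ 2 = -3) {k : F} (hk : k ≠ 0) {x : F}
    (hx : x ^ 9 - 96 * k * x ^ 6 + 48 * k ^ 2 * x ^ 3 + 64 * k ^ 3 = 0) :
    ∃ ζ : F, ζ ^ 9 = 1 ∧ ζ ^ 3 ≠ 1 := by
  -- `w = x³/(4k)` is a root of `w³ − 24w² + 3w + 1`
  set w : F := x ^ 3 / (4 * k) with hw
  have hk4 : (4 * k) ≠ 0 := mul_ne_zero (by norm_num) hk
  have hg : w ^ 3 - 24 * w ^ 2 + 3 * w + 1 = 0 := by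
    have : w ^ 3 - 24 * w ^ 2 + 3 * w + 1 =
        (x ^ 9 - 96 * k * x ^ 6 + 48 * k ^ 2 * x ^ 3 + 64 * k ^ 3) / (4 * k) ^ 3 := by
      rw [hw]; field_simp; ring
    rw [this, hx, zero_div]
  -- `η` is a root of `η³ − 3η + 1`, `η² ≠ 1`
  set η : F := (-2 + 24 * w - w ^ 2) / 3 with hη
  have hη3 : η ^ 3 - 3 * η + 1 = 0 := by
    have : η ^ 3 - 3 * η + 1 =
        ((-w ^ 3 + 48 * w ^ 2 - 579 * w + 73) / 27) * (w ^ 3 - 24 * w ^ 2 + 3 * w + 1) := by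
      rw [hη]; ring
    rw [this, hg, mul_zero]
  have hη1 : η ^ 2 - 1 ≠ 0 := by
    intro h0
    have h1 : (η - 1) * (η + 1) = 0 := by linear_combination h0
    rcases mul_eq_zero.mp h1 with h1 | h1
    · have e : η = 1 := by linear_combination h1
      have h := hη3
      rw [e] at h; norm_num at h
    · have e : η = -1 := by linear_combination h1
      have h := hη3
      rw [e] at h; norm_num at h
  -- the candidate `ζ = N/D`, `ζ³ = (−1 + θ)/2`
  set N : F := η * (η ^ 2 - 1) + θ with hN
  set D : F := 2 * (η ^ 2 - 1) with hD
  have hD0 : D ≠ 0 := mul_ne_zero two_ne_zero hη1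
  have hcube : 2 * N ^ 3 - (-1 + θ) * D ^ 3 = 0 := by
    rw [hN, hD]
    linear_combination (6 * η ^ 3 - 6 * η + 2 * θ) * hθ +
      (2 * η ^ 6 - 2 * η ^ 3 * θ + 6 * η ^ 3 + 6 * η ^ 2 + 6 * η * θ - 6 * η + 2 * θ - 8) * hη3
  have h3 : (N / D) ^ 3 = (-1 + θ) / 2 := by
    rw [div_pow, div_eq_div_iff (pow_ne_zero 3 hD0) two_ne_zero]
    linear_combination hcube
  have hω : ((-1 + θ) / 2) ^ 3 = (1 : F) := by linear_combination (θ - 3) / 8 * hθ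
  refine ⟨N / D, ?_, ?_⟩
  · calc (N / D) ^ 9 = ((N / D) ^ 3) ^ 3 := by ring
      _ = 1 := by rw [h3, hω]
  · rw [h3]
    intro h1
    have e : θ = 3 := by linear_combination 2 * h1
    have h := hθ
    rw [e] at h; norm_num at h

/-! ## §2 The abscissa of a point `P` with `3P ∈ {(0, ±√k)}`: `φ₃(x(P)) = 0` -/

omit [CharZero F] in
/-- `preΨ₄` of the Mordell curve `y² = x³ + k` is `2x⁶ + 40k x³ − 16k²`. [folklore] -/
theorem mordellCurve_preΨ₄_eval (k x : F) :
    (mordellCurve k).preΨ₄.eval x = 2 * x ^ 6 + 40 * k * x ^ 3 - 16 * k ^ 2 := by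
  simp only [WeierstrassCurve.preΨ₄, mordellCurve, WeierstrassCurve.b₂, WeierstrassCurve.b₄,
    WeierstrassCurve.b₆, WeierstrassCurve.b₈, eval_add, eval_mul, eval_pow, eval_C, eval_X,
    eval_ofNat]
  ring

omit [CharZero F] in
/-- `ψ₂` of the Mordell curve evaluates to `2y`. [folklore] -/
theorem mordellCurve_ψ₂_evalEval (k x y : F) : (mordellCurve k).ψ₂.evalEval x y = 2 * y := by
  rw [WeierstrassCurve.ψ₂, Affine.evalEval_polynomialY]
  simp [mordellCurve]

omit [CharZero F] in
/-- **`φ₃` on `y² = x³ + k`**: at a point `(x, y)` of the curve, Mathlib's numerator of `x(3P)` is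
`φ₃(x, y) = x·Ψ₃(x)² − preΨ₄(x)·(2y)² = x⁹ − 96k x⁶ + 48k² x³ + 64k³` (Silverman, Exercise 3.7).
[cite: SilvermanAEC2009, Exercise 3.7] -/
theorem mordellCurve_φ_three_evalEval {k x y : F} (heq : y ^ 2 = x ^ 3 + k) :
    ((mordellCurve k).φ 3).evalEval x y = x ^ 9 - 96 * k * x ^ 6 + 48 * k ^ 2 * x ^ 3 + 64 * k ^ 3 := by
  rw [WeierstrassCurve.φ_three, evalEval_sub, evalEval_mul, evalEval_mul, evalEval_C, evalEval_C,
    evalEval_pow, evalEval_pow, evalEval_C, eval_X, JZeroThree.mordellCurve_Ψ₃_eval,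
    mordellCurve_preΨ₄_eval, mordellCurve_ψ₂_evalEval]
  linear_combination (-4) * (2 * x ^ 6 + 40 * k * x ^ 3 - 16 * k ^ 2) * heq

omit [CharZero F] in
/-- **If `3P = (0, s)` then `φ₃(x(P)) = 0`.** For `P = (x, y)` on `y² = x³ + k`: `3P ≠ O`, so
`3P = (φ₃/ψ₃², ·)` (tree `zsmul_some_eq_some_φ_div`, Silverman Ex. 3.7 (d)); comparing abscissae,
`φ₃(x, y) = 0`, i.e. `x⁹ − 96k x⁶ + 48k² x³ + 64k³ = 0`. [cite: SilvermanAEC2009, Exercise 3.7 (d)] -/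
theorem phi_three_eq_zero_of_three_smul_eq {k x y s : F} (h : (mordellCurve k).toAffine.Nonsingular x y)
    (h0 : (mordellCurve k).toAffine.Nonsingular 0 s)
    (h3 : (3 : ℕ) • (Affine.Point.some x y h : (mordellCurve k).toAffine.Point) = .some 0 s h0) :
    x ^ 9 - 96 * k * x ^ 6 + 48 * k ^ 2 * x ^ 3 + 64 * k ^ 3 = 0 := by
  have heq : y ^ 2 = x ^ 3 + k := (mordellCurve_equation_iff k x y).mp h.left
  have h3z : (3 : ℤ) • (Affine.Point.some x y h : (mordellCurve k).toAffine.Point) = .some 0 s h0 := by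
    rw [show (3 : ℤ) = ((3 : ℕ) : ℤ) from rfl, natCast_zsmul]; exact h3
  have hψ : ((mordellCurve k).ψ 3).evalEval x y ≠ 0 := by
    intro hψ0
    have := (Affine.Point.zsmul_some_eq_zero_iff h 3).mpr hψ0
    rw [h3z] at this
    exact Affine.Point.some_ne_zero h0 this
  obtain ⟨y₁, hns, e⟩ := Affine.Point.zsmul_some_eq_some_φ_div h hψ
  rw [h3z] at e
  have hx : (0 : F) = ((mordellCurve k).φ 3).evalEval x y / ((mordellCurve k).ψ 3).evalEval x y ^ 2 := by
    injection e with hx _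
  rw [eq_div_iff (pow_ne_zero 2 hψ), zero_mul, mordellCurve_φ_three_evalEval heq] at hx
  exact hx.symm

/-! ## §3 No point of order `9` when `ζ₉ ∉ F` -/

/-- **No point of order `9` on `y² = x³ + k` over a field `F ∋ √−3` without a primitive ninth root
of unity.** `θ² = −3` in `F`, `hζ : ∀ z, z⁹ = 1 → z³ = 1`, `k ≠ 0`: every `F`-point `P` with `9P = O`
has `3P = O`. Proof: if `3P = Q ≠ O` then `Q` has order `3`, so `x(Q) = 0` or `x(Q)³ = −4k`.
If `x(Q) = 0`, §2 and §1 give a primitive ninth root of unity from `x(P)` — contradiction. If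
`x(Q) ≠ 0`, put `ν = [ω] − 1` (`[ω]` the CM automorphism `(x, y) ↦ (ωx, y)`, `ω = (θ − 1)/2`):
`3·ν(Q) = 0`, `[ω]` fixes every `3`-torsion point `T` with `x(T) = 0`, and the chord identity
`T + [ω]T + [ω]²T = O` gives `ν(ν(T)) = −3[ω]T = O` for every `3`-torsion `T` with `x(T) ≠ 0`; hence
`R = ν(P)` satisfies `9R = O`, `3R = ν(Q) ≠ O` (as `x(Q) ≠ 0`) and `ν(3R) = ν(ν(Q)) = O`, i.e.
`x(3R) = 0` — the first case applies to `R`. This is the explicit form, for `j = 0`, of «`E[𝔭³]`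
rational forces `μ₉`» (the level-`3` abscissae generate `ℚ(ζ₉)⁺`). [cite: SilvermanAEC2009, Exercise 3.7 and III.10] -/
theorem three_smul_eq_zero_of_nine_smul_eq_zero {θ : F} (hθ : θ ^ 2 = -3)
    (hζ : ∀ z : F, z ^ 9 = 1 → z ^ 3 = 1) {k : F} (hk : k ≠ 0)
    (P : (mordellCurve k).toAffine.Point) (h9 : (9 : ℕ) • P = 0) : (3 : ℕ) • P = 0 := by
  -- the CM automorphism and its fixed points
  set ω : F := (θ - 1) / 2 with hωdef
  have hω : ω ^ 2 + ω + 1 = 0 := omega_relation hθ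
  have hω3 : ω ^ 3 = 1 := by linear_combination (ω - 1) * hω
  have hω0 : ω ≠ 0 := by rintro h0; rw [h0] at hω; norm_num at hω
  have hω1 : ω ≠ 1 := by rintro h1; rw [h1] at hω; norm_num at hω
  obtain ⟨φ, hφ⟩ := exists_cm_automorphism k hω0 hω3
  -- case A: a point `R` with `9R = 0` and `3R = (0, s)` is impossible
  have caseA : ∀ (R : (mordellCurve k).toAffine.Point) (s : F)
      (h0 : (mordellCurve k).toAffine.Nonsingular 0 s), (9 : ℕ) • R = 0 → (3 : ℕ) • R = .some 0 s h0 → False := by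
    intro R s h0 h9R h3R
    rcases R with _ | ⟨x, y, hxy⟩
    · change (3 : ℕ) • (0 : (mordellCurve k).toAffine.Point) = _ at h3R
      rw [smul_zero] at h3R
      exact (Affine.Point.some_ne_zero h0 h3R.symm).elim
    · obtain ⟨ζ, h9, h3⟩ := exists_ninth_root_of_phi_three_root hθ hk
        (phi_three_eq_zero_of_three_smul_eq hxy h0 h3R)
      exact h3 (hζ ζ h9)
  by_contra h3
  -- `Q = 3P` is a non-zero `3`-torsion point
  have hQ3 : (3 : ℕ) • ((3 : ℕ) • P) = 0 := by rw [← mul_nsmul', show 3 * 3 = 9 by norm_num]; exact h9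
  obtain ⟨xq, yq, hq, hQ⟩ : ∃ xq yq hq, (3 : ℕ) • P = Affine.Point.some xq yq hq := by
    rcases hP : (3 : ℕ) • P with _ | ⟨xq, yq, hq⟩
    · exact (h3 hP).elim
    · exact ⟨xq, yq, hq, rfl⟩
  rw [hQ] at hQ3
  rcases JZeroThree.mordellCurve_three_torsion_x hq hQ3 with ⟨hx0, -⟩ | ⟨hx3, -⟩
  · -- case A for `P` itself
    subst hx0
    exact caseA P yq hq h9 hQ
  · -- case B: `x(Q) ≠ 0`; pass to `R = φ P − P`
    have hxq : xq ≠ 0 := by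
      rintro rfl
      have : (4 : F) * k = 0 := by linear_combination hx3
      exact hk ((mul_eq_zero.mp this).resolve_left (by norm_num))
    -- `φ` fixes the `3`-torsion points with `x = 0`
    have hfix : ∀ (y₀ : F) (h₀ : (mordellCurve k).toAffine.Nonsingular 0 y₀),
        φ (.some 0 y₀ h₀) = .some 0 y₀ h₀ := by
      intro y₀ h₀
      obtain ⟨h', hP'⟩ := hφ 0 y₀ h₀
      rw [hP']; congr 1; exact mul_zero ω
    -- `ν(ν(T)) = 0` for the `3`-torsion point `T = Q` with `x(Q) ≠ 0`: chord identity
    obtain ⟨h₁, hφQ⟩ := hφ xq yq hq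
    obtain ⟨h₂, hφφQ⟩ := hφ (ω * xq) yq h₁
    set Q : (mordellCurve k).toAffine.Point := .some xq yq hq with hQdef
    have hchord : Q + φ Q + φ (φ Q) = 0 := by
      rw [hQdef, hφQ, hφφQ, some_add_some_rot hω hxq hq h₁ h₂, neg_add_cancel]
    have hνν : φ (φ Q - Q) - (φ Q - Q) = 0 := by
      have h3φQ : (3 : ℕ) • φ Q = 0 := by rw [← map_nsmul, hQ3, map_zero]
      have e1 : φ (φ Q - Q) - (φ Q - Q) = (Q + φ Q + φ (φ Q)) - (3 : ℕ) • φ Q := by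
        rw [map_sub]
        simp only [succ_nsmul, zero_nsmul, zero_add]
        abel
      rw [e1, hchord, h3φQ, sub_zero]
    -- `R = φ P − P`: `9R = 0`, `3R = φ Q − Q ≠ 0` is `3`-torsion with `ν(3R) = 0`
    set R : (mordellCurve k).toAffine.Point := φ P - P with hRdef
    have h9R : (9 : ℕ) • R = 0 := by rw [hRdef, nsmul_sub, ← map_nsmul, h9, map_zero, sub_zero]
    have h3R : (3 : ℕ) • R = φ Q - Q := by rw [hRdef, nsmul_sub, ← map_nsmul, hQ]
    have hR0 : φ Q - Q ≠ 0 := by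
      intro h0
      have e : φ Q = Q := sub_eq_zero.mp h0
      rw [hQdef, hφQ] at e
      have hx : ω * xq = xq := by injection e
      have : (ω - 1) * xq = 0 := by linear_combination hx
      rcases mul_eq_zero.mp this with h1 | h1
      · exact hω1 (by linear_combination h1)
      · exact hxq h1
    -- `φ Q − Q` is a non-zero `3`-torsion point fixed by `φ`, hence has `x = 0`
    have hT3 : (3 : ℕ) • (φ Q - Q) = 0 := by
      rw [nsmul_sub, ← map_nsmul, hQ3, map_zero, sub_zero]
    obtain ⟨xt, yt, ht, hT⟩ : ∃ xt yt ht, φ Q - Q = Affine.Point.some xt yt ht := by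
      rcases hP : φ Q - Q with _ | ⟨xt, yt, ht⟩
      · exact (hR0 hP).elim
      · exact ⟨xt, yt, ht, rfl⟩
    rw [hT] at hT3 hνν h3R
    rcases JZeroThree.mordellCurve_three_torsion_x ht hT3 with ⟨hxt0, -⟩ | ⟨hxt3, -⟩
    · subst hxt0
      exact caseA R yt ht h9R h3R
    · -- `x(T) ≠ 0` contradicts `φ T = T`
      have hxt : xt ≠ 0 := by
        rintro rfl
        have : (4 : F) * k = 0 := by linear_combination hxt3
        exact hk ((mul_eq_zero.mp this).resolve_left (by norm_num))
      obtain ⟨h', hφT⟩ := hφ xt yt ht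
      have e : φ (.some xt yt ht) = .some xt yt ht := sub_eq_zero.mp hνν
      rw [hφT] at e
      have hx : ω * xt = xt := by injection e
      have : (ω - 1) * xt = 0 := by linear_combination hx
      rcases mul_eq_zero.mp this with h1 | h1
      · exact hω1 (by linear_combination h1)
      · exact hxt h1

/-- **`E_k(F)[3^∞] = E_k(F)[3]`** under the same hypotheses: every point killed by a power of `3` is
killed by `3`. [cite: SilvermanAEC2009, Exercise 3.7 and III.10] -/
theorem three_smul_eq_zero_of_pow_smul_eq_zero {θ : F} (hθ : θ ^ 2 = -3)
    (hζ : ∀ z : F, z ^ 9 = 1 → z ^ 3 = 1) {k : F} (hk : k ≠ 0)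
    (P : (mordellCurve k).toAffine.Point) {n : ℕ} (hn : (3 : ℕ) ^ n • P = 0) : (3 : ℕ) • P = 0 := by
  induction n generalizing P with
  | zero =>
    rw [pow_zero, one_smul] at hn
    rw [hn, smul_zero]
  | succ n ih =>
    rcases n with _ | n
    · simpa using hn
    · -- `3^(n+2) • P = 9 • (3^n • P)`: so `3 • (3^n • P) = 0`, i.e. `3^(n+1) • P = 0`
      have h9 : (9 : ℕ) • ((3 : ℕ) ^ n • P) = 0 := by
        rw [← mul_nsmul', show 9 * 3 ^ n = 3 ^ (n + 1 + 1) by ring]; exact hn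
      have h3 := three_smul_eq_zero_of_nine_smul_eq_zero hθ hζ hk _ h9
      rw [← mul_nsmul', show 3 * 3 ^ n = 3 ^ (n + 1) by ring] at h3
      exact ih P h3

end Summit.BirchSwinnertonDyer.BirchSwinnertonDyer.Theorems.PrintCFram.NoZetaNine

end
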